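import Literature.Computability.AlgebraicComplexity.LR21Datum
import Literature.Computability.AlgebraicComplexity.LREqualityWeights
import Literature.Computability.AlgebraicComplexity.GrenetGradedNormalForm

/-! # Crux `UniqStep` (stmt-ValiantsHypothesis-17834), line `Sketch` — stub `stub_lrEqualityNormalForm`:
# the equality case of Landsberg–Ressayre Thm. 2.8 (structure: the graded normal form)

WHAT. For `N ≥ 3`, an affine determinantal representation `A` of `per_N` of size `m = 2^N - 1`
that is equivariant (exact lifts) for the left monomial symmetries `leftMonomialSubst ℂ N` is, for
every labelling `e` of the subsets of `Fin N`, gauge/transpose-equivalent (`DetReprEquivalent ⊥`)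
to a GENERALISED GRENET MATRIX `G(a, e)` (Grenet's `(univ, ∅)` minor of `1 - adj` for the
branching program on the subsets, sign `(-1)^(e univ + e ∅)`, in which the arc `S → insert k S`
carries the linear form `∑_c a S k c · x_{k,c}`; `GeneralisedGrenetMatrix.lean`) with
`det G(a, e) = per_N`.

Proof. (1) `exists_torusData`: as in the tree's proof of LR17 Thm. 2.8
(`two_pow_sub_one_le_of_isRegular`), regularity (von zur Gathen,
`vonzurGathen1987_perm_detRepr_rank_holds`) and the exact lifts of the torus element
`diag(2, 3, 5, …)` and of the row permutations give a torus datum `D` on `ℂᵐ` (`LRTorusWeights`)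
with `dim ker Λ = 1`, an injective member of the pencil and all permutation lifts.  (2) At
equality `m = 2^N - 1` the count `LRWeightCount.two_pow_sub_one_le_finrank` is sharp: the weight
spaces `E (wt 𝟙_T)` (`T ≠ ∅`) and `F (wt 𝟙_S)` (`S ≠ univ`) are lines exhausting `ℂᵐ`, and in
adapted bases `Λ` is the partial identity while `A_{kc}` is supported on the arcs `S → S ∪ {k}`
(`LRPencil.TorusData.exists_adapted_bases`, `LREqualityWeights.lean`).  (3) The matrix of the
pencil in these bases is the TRANSPOSE of a generalised Grenet matrix, `G(a, e) = P · Aᵀ · Q`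
with `det P · det Q = 1` after rescaling the forms leaving `∅`
(`LRPencil.genRepr_eq_of_adapted_bases`, `GrenetGradedNormalForm.lean`); hence
`det G(a, e) = det A = per_N` and `A ~ G(a, e)` through the transpose branch of
`DetReprEquivalent ⊥`.

WHY. Third step of `UniqStep_of` (line `Sketch`): the bet makes an optimal honest projection of
`per_N` left-monomially symmetric; its size `pdc(per_N) = 2^N - 1` is equality in LR17 Thm. 2.8,
and this stub puts it in the graded normal form on which S4 (`stub_orbitProportional`) and S5
(`stub_gradedRigidity`) operate.

SOURCE. J. M. Landsberg, N. Ressayre, *Permanent v. determinant: an exponential lower bound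
assuming symmetry and a potential path towards Valiant's conjecture*, Differential Geom. Appl. 55
(2017), Thm. 2.8 and §6 (key `LandsbergRessayre2017`); B. Grenet (2011), Thm. 1 (key
`Grenet2011`); folklore (the equality case).
-/

-- D-0017 layout: Sub = Summit for this single-conjunct summit, so the namespace repeats a component.
set_option linter.dupNamespace false

namespace Summit.ValiantsHypothesis.ValiantsHypothesis.Theorems.ProjectionStabilityUniqStep

open MvPolynomial
open scoped BigOperators Matrix Kronecker
open Literature.Computability.AlgebraicComplexity LRPencil

noncomputable section

/-! ### The torus datum of a left-equivariant representation of `per_N` -/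

/-- **The one-sided torus datum with all count hypotheses** (the data half of the tree's proof of
LR17 Thm. 2.8, `two_pow_sub_one_le_of_isRegular`, made reusable): for `N ≥ 3` and `A` an affine
determinantal representation of `per_N` over `ℂ` equivariant (exact lifts) for
`leftMonomialSubst ℂ N`, there is a `TorusData` on `ℂⁿ` with `Λ = Ã(0)`, `A k j = A_{kj}` (one
exact lift of `diag(2, 3, 5, …) ⊗ 1`), `dim ker Λ = 1` (von zur Gathen's regularity), an injective
member of the pencil (`Ã(1)`), and an exact lift of every row permutation.
[cite: LandsbergRessayre2017, §6] -/
theorem exists_torusData {N n : ℕ} (hN : 3 ≤ N)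
    {A : Matrix (Fin n) (Fin n) (MvPolynomial (Fin N × Fin N) ℂ)}
    (hA : IsEquivariantDetRepr (leftMonomialSubst ℂ N) (perPoly (Fin N) ℂ) A) :
    ∃ D : TorusData N (Fin n → ℂ),
      D.Λ = Matrix.toLin' (constPart A) ∧
      D.A = (fun k j => Matrix.toLin' (coeffMat A (k, j))) ∧
      Module.finrank ℂ (LinearMap.ker D.Λ) = 1 ∧
      (∃ x : Fin N → Fin N → ℂ, Function.Injective (D.Λ + ∑ k, ∑ j, x k j • D.A k j)) ∧
      ∀ σ : Equiv.Perm (Fin N), Nonempty (Lift D.Λ D.A σ fun _ => (1 : ℂ)) := by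
  classical
  have haff : ∀ r c, (A r c).totalDegree ≤ 1 := hA.1.1
  have hdet : A.det = perPoly (Fin N) ℂ := hA.1.2
  have hn : 0 < n := pos_of_det_eq_perPoly (by omega) hdet
  have hreg : IsRegularDetRepr (perPoly (Fin N) ℂ) A :=
    hA.isRegular_perPoly vonzurGathen1987_perm_detRepr_rank_holds hN
  set Λm : Matrix (Fin n) (Fin n) ℂ := constPart A with hΛm
  set Am : Fin N → Fin N → Matrix (Fin n) (Fin n) ℂ := fun k j => coeffMat A (k, j) with hAm
  -- the torus element `diag(2, 3, 5, …)` and its lift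
  set p : Fin N → ℕ := fun i => Nat.nth Nat.Prime i with hpdef
  have hprime : ∀ i, (p i).Prime := fun i => Nat.prime_nth_prime _
  have hpinj : Function.Injective p := fun _ _ h =>
    Fin.ext (Nat.nth_injective Nat.infinite_setOf_prime h)
  have hp0 : ∀ i, ((fun i => (p i : ℂ)) i) ≠ 0 := fun i =>
    Nat.cast_ne_zero.2 (hprime i).ne_zero
  obtain ⟨g, h, hΛ, hw⟩ := exists_matrix_lift hA (diagUnit_mem ℂ (fun i => (p i : ℂ)) hp0)
  have hAt : ∀ k j, (g : Matrix (Fin n) (Fin n) ℂ) * Am k j =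
      (p k : ℂ) • (Am ((1 : Equiv.Perm (Fin N)) k) j * (h : Matrix (Fin n) (Fin n) ℂ)) := by
    intro k j
    have e := hw (k, j)
    rw [coe_diagUnit, sum_kron_diagonal_smul] at e
    rw [mul_eq_of_eq_mul_mul_inv e, Matrix.smul_mul]
    rfl
  let L : Lift (Matrix.toLin' Λm) (fun k j => Matrix.toLin' (Am k j)) 1 (fun k => (p k : ℂ)) :=
    liftOfMatrices Λm Am 1 _ hp0 g h hΛ hAt
  -- the permutation lifts
  have hperm : ∀ σ : Equiv.Perm (Fin N),
      Nonempty (Lift (Matrix.toLin' Λm) (fun k j => Matrix.toLin' (Am k j)) σ fun _ => (1 : ℂ)) := by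
    intro σ
    obtain ⟨g', h', hΛ', hw'⟩ := exists_matrix_lift hA (permUnit_mem ℂ σ)
    refine ⟨liftOfMatrices Λm Am σ _ (fun _ => one_ne_zero) g' h' hΛ' fun k j => ?_⟩
    have e := hw' (k, j)
    rw [coe_permUnit, sum_kron_permMatrix_smul] at e
    rw [mul_eq_of_eq_mul_mul_inv e, one_smul]
  -- regularity: the kernel of `Λ` is a line, `C` acts on it by `γ₀`
  have hK : Module.finrank ℂ (LinearMap.ker (Matrix.toLin' Λm)) = 1 :=
    finrank_ker_toLin'_eq_one hn hreg.2
  obtain ⟨γ₀, hγ₀, hker⟩ := exists_eigenvalue_of_finrank_ker_eq_one _ L.C L.map_ker_eq hK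
  let D : TorusData N (Fin n → ℂ) :=
    { Λ := Matrix.toLin' Λm, A := fun k j => Matrix.toLin' (Am k j), p := p,
      prime := hprime, p_inj := hpinj, L := L, γ₀ := γ₀, ker_le := hker, γ₀_ne := hγ₀ }
  exact ⟨D, rfl, rfl, hK, exists_injective_member haff hdet, hperm⟩

/-! ### The normal form -/

/-- **STUB S3** of line `Sketch` of crux `UniqStep` — the equality case of Landsberg–Ressayre
Thm. 2.8, structure half: for `N ≥ 3`, an affine determinantal representation `A` of `per_N` of
size `m = 2^N - 1` which is equivariant (exact lifts) for the left monomial symmetries is, for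
every labelling `e` of the subsets of `Fin N`, `DetReprEquivalent ⊥` (gauge and transpose:
`G(a, e) = P · Aᵀ · Q`, `det P det Q = 1`) to a generalised Grenet matrix `G(a, e)` (the displayed
matrix: Grenet's `(univ, ∅)` minor with the arc `S → insert k S` carrying `∑_c a S k c · x_{k,c}`)
with `det G(a, e) = per_N`. [cite: LandsbergRessayre2017, Thm. 2.8] -/
theorem stub_lrEqualityNormalForm :
    ∀ (N m : ℕ), 3 ≤ N → m + 1 = 2 ^ N →
      ∀ A : Matrix (Fin m) (Fin m) (MvPolynomial (Fin N × Fin N) ℂ),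
        IsEquivariantDetRepr (leftMonomialSubst ℂ N) (perPoly (Fin N) ℂ) A →
        ∀ e : Finset (Fin N) ≃ Fin (m + 1),
          ∃ a : Finset (Fin N) → Fin N → Fin N → ℂ,
            ((-1 : MvPolynomial (Fin N × Fin N) ℂ) ^ ((e Finset.univ : ℕ) + (e ∅ : ℕ)) •
                (((1 - Matrix.of fun S T : Finset (Fin N) =>
                    ∑ k : Fin N, if k ∉ S ∧ T = insert k S
                      then ∑ c : Fin N, a S k c • (X (k, c) : MvPolynomial (Fin N × Fin N) ℂ)
                      else 0).submatrix e.symm e.symm).submatrix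
                  (Fin.succAbove (e Finset.univ)) (Fin.succAbove (e ∅)))).det = perPoly (Fin N) ℂ ∧
            DetReprEquivalent ⊥ A
              ((-1 : MvPolynomial (Fin N × Fin N) ℂ) ^ ((e Finset.univ : ℕ) + (e ∅ : ℕ)) •
                (((1 - Matrix.of fun S T : Finset (Fin N) =>
                    ∑ k : Fin N, if k ∉ S ∧ T = insert k S
                      then ∑ c : Fin N, a S k c • (X (k, c) : MvPolynomial (Fin N × Fin N) ℂ)
                      else 0).submatrix e.symm e.symm).submatrix
                  (Fin.succAbove (e Finset.univ)) (Fin.succAbove (e ∅)))) := by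
  intro N m hN hm A hA e
  classical
  have haff : ∀ r c, (A r c).totalDegree ≤ 1 := hA.1.1
  have hdet : A.det = perPoly (Fin N) ℂ := hA.1.2
  -- (1) the torus datum; (2) the adapted bases at equality `m + 1 = 2^N`
  obtain ⟨D, hDΛ, hDA, hK, hgen, hperm⟩ := exists_torusData hN hA
  have hdim : Module.finrank ℂ (Fin m → ℂ) + 1 = 2 ^ N := by rw [Module.finrank_fin_fun]; exact hm
  obtain ⟨f, g, hf, hg, hΛ, hΛ0, hAt, hA0⟩ := D.exists_adapted_bases (by omega) hK hgen hperm hdim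
  rw [hDΛ] at hΛ hΛ0
  rw [hDA] at hAt hA0
  simp only [Matrix.toLin'_apply] at hΛ hΛ0 hAt hA0
  -- (3) the graded normal form `G(a, e) = P · Aᵀ · Q`, `det P det Q = 1`
  obtain ⟨a, P, Q, hG, hPQ⟩ :=
    genRepr_eq_of_adapted_bases (K := ℂ) (by omega) e haff hf hg hΛ hΛ0 hAt hA0
  refine ⟨a, ?_, detReprEquivalent_bot_iff.2 ⟨P, Q, Or.inr hG⟩⟩
  rw [hG, det_map_C_mul_mul_map_C, hPQ, map_one, one_mul, Matrix.det_transpose, hdet]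

end

end Summit.ValiantsHypothesis.ValiantsHypothesis.Theorems.ProjectionStabilityUniqStep
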